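/-
Copyright (c) 2026 the pub-hodgecm-mathlib formalisation cell (harness21).  Prover seat hodgecm-mathlib-LH7-p07 (g2), Track B «K2-LIT» ∕ hLiu418, organ F4 (G-gen),
B3-b FILE 2b «THE PLACE-TUPLE INDUCTION IN THE LETTERS OF RECORD» (LEAD F0P6-plan (g14) BATCH #152 (1) ∕ #158; F4 lead K2Liu-p27 (g2)).  THEOREMS ONLY.
-/
import Summits.HodgeConjecture.HodgeConjecture.Theorems.K2LiuArchSWDataTuplesDefs       -- ★ p863253 FILE 1: `tupleVec`, `frame_tupleVec_eq_tensorPi`, `tupleRest_update`, slot linearity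
import Summits.HodgeConjecture.HodgeConjecture.Theorems.K2LiuArchSWDataInductionLift    -- ★ FILE 2a: `goodAt_tuple_of_placeLetters` (generic lift + recursion)
import Summits.HodgeConjecture.HodgeConjecture.Theorems.K2LiuFaceGLetterDefs            -- ★ p862888: `IsArchStable`, `genFamily`, `HasArchDeriv`
import HarnessLib

/-!
# Crux `HLiu418`, organ F4 (G-gen), B3-b FILE 2b: THE PLACE-TUPLE INDUCTION IN THE LETTERS OF RECORD — `Good` AT EVERY TUPLE VECTOR (★ FILE 3's letter (gen))

Cell `hodgecm-mathlib`, crux item hLiu418 = `stmt-HodgeConjecture-24832` (helper lane `--kind proof --supports stmt-HodgeConjecture-24832 --as helper`,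
count-neutral; closes no socket); squad K2 ∕ K2Liu + F0∕P3c∕LH7; LEAD F0P6-plan (g14); F4 lead ∕ desk K2Liu-p27 (g2); boxes K2E5-r02 (g6), K2Liu-audit1 (g2);
consumer K2E3-p23 (g8) ★ p863249 `K2LiuArchSWDataFinalPassage.forall_domain_good_of_archGenerators` (letter (gen) at `t := tupleVec`).  THEOREMS ONLY (no `def`,
no `instance`, no notation, no named-fact hypothesis, no `sorry`).

WHAT.  ★ FILE 2a `goodAt_tuple_of_placeLetters` instantiated at the big datum `𝔻 ⊗ V′` of socket #42F′: `M := 𝓢((L⁺ ⊗ ℝ)^{n′+n′})`, `E a f := piSchwartzBruhatEquiv (a ⊗ f)`,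
`Adm V := FiniteDimensional ℂ V ∧ IsArchStable … V`, reading `g := genFamily …` (the twisted Siegel–Weil generator family), `Der ⟨X, hX⟩ y y′ := HasArchDeriv hX (y s₀ ·)
(y′ s₀ ·)`, `s₀ = (3 − n)∕2`, tuple-vector map `t := tupleVec` (★ FILE 1), and at each real place `σ` with the rest frozen the section functional
`SW_σ,rest v := g (E (𝒥_σ⁻¹ ((e_* v) ⊠ B⁻¹(tupleRest σ rest))) f)` (built inside the proof; `𝒥_σ` = ★ J2c's frame chain; `SW_σ,rest (B⁻¹F) = g (E (tupleVec (update rest σ F)) f)`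
by ★ `frame_tupleVec_eq_tensorPi` + ★ `tupleRest_update`).
* §1 **`genFamily_add`**, **`genFamily_smul`** — the generator family is additive and homogeneous in the datum (★ `swSectionTensor_add ∕ _smul`; ★ 0c's
  `twistedGen_add ∕ _smul` in `genFamily` spelling); **`vac_good_of_base`** — the (vac) letter from `hGgen`'s (base) at any admissible hol-cut domain containing the
  all-vacuum tuple vector, by (congr).
* §2 **`good_tupleVec_of_frame`** — the induction for an ABSTRACT family of one-place frames `J σ` reading tuple vectors as `(e_* B⁻¹(a σ)) ⊠ B⁻¹(tupleRest σ a)`: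
  hypotheses = `hGgen`'s (congr)(zero)(add)(smul)(deriv) bytes verbatim + (dom) (★ FILE 3's bytes) + per place the see-saw pivot (piv) in `ha`-form, the block first
  fundamental theorems `hR hS` (★ B3-a ED. 3 bytes), the two `Good`-free derivative letters (DX⁺)(DX⁻) at tuple level, and (vac); conclusion = ★ FILE 3's letter
  (gen) at `t := tupleVec`, bytes verbatim.
* §3 **`good_tupleVec`** — the same at `J σ := 𝒥_σ` (★ J2c's chain; (piv) then literally in ★ (P-arch) `K2LiuArchRightLegPlacePin`'s `ha` currency), by ★ FILE 1
  `frame_tupleVec_eq_tensorPi`.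
References: [Howe1989] §3; [KudlaRallis1994] §3; [Folland1989] §1.7, Prop. (4.39); [Weil1964] Chap. I n° 12 — citations; the file is the assembly of ★ FILE 1 ∕ 2a.
HONEST LABEL.  Count-neutral helper; `HC_CM` is proved only modulo the 7 printed citations (2 remaining named inputs: hLiu418 = `stmt-HodgeConjecture-24832`,
h413 = `stmt-HodgeConjecture-24833`) until rung 0 closes.  Residual letters BY VALUE after this file: (piv) per place (pivot file: (P-arch) ★ + (R-grp) + (R-scal) ★),
`hR hS` (★ bridge transport ∘ ★ `isUnitaryInvariant_iff_mem_adjoin`), (DX±), (dom) (Hermite-span degree ledger + arch-stability of Hermite spans), (vac) ((base) + `HL`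
at a hol-cut domain containing ★ `archGaussianOfRecord`).
-/

set_option autoImplicit false
set_option linter.dupNamespace false -- the mandated namespace repeats `HodgeConjecture.HodgeConjecture`

noncomputable section

open scoped Classical Matrix MatrixGroups TensorProduct Kronecker SchwartzMap Real
open MvPolynomial Complex
open NumberField NumberField.InfinitePlace NumberField.mixedEmbedding IsDedekindDomain
open Literature.Analysis.SegalBargmann Literature.RepresentationTheory.HeisenbergGroup
open Literature.NumberTheory.Automorphic Literature.NumberTheory.Automorphic.UnitaryGroup Literature.NumberTheory.GaloisRepresentations
open Literature.NumberTheory.Weil1964 Literature.NumberTheory.Weil1964.MpS Literature.NumberTheory.Weil1964.UnitaryWeil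
open Literature.RepresentationTheory.HarrisKudlaSweet1996
open Literature.RepresentationTheory.KonnoKonno2007 Literature.RepresentationTheory.KonnoKonno2007.RealDualPair
open Literature.RepresentationTheory.KonnoKonno2007.RealDualPair.UForm
open Literature.NumberTheory.GelbartRogawski1991 Literature.NumberTheory.GelbartRogawski1991.GRConstruction
open Literature.NumberTheory.GelbartRogawski1991.UnitaryDualPair
open Literature.NumberTheory.GelbartRogawski1991.UnitaryDualPair.LocalSplitting
open Literature.NumberTheory.K2Lit.SiegelDoubled
open Literature.NumberTheory.Automorphic.Liu2021
open Literature.NumberTheory.Automorphic.Liu2021.Def411WeilCarriers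
open Literature.NumberTheory.Automorphic.Liu2021.Def411WeilCarriersDoubling
open Literature.RepresentationTheory.Liu2021
open Summit.HodgeConjecture.HodgeConjecture.Cruxes.HLiu418.K2LiuArchSectionPlaceBlock
open Summit.HodgeConjecture.HodgeConjecture.Cruxes.HLiu418.K2LiuFaceGLetterDefs (IsArchStable genFamily HasArchDeriv)
open Summit.HodgeConjecture.HodgeConjecture.Cruxes.HLiu418.K2LiuArchSWDataTuplesDefs
open Summit.HodgeConjecture.HodgeConjecture.Cruxes.HLiu418.K2LiuArchSWDataInductionLift

namespace Summit.HodgeConjecture.HodgeConjecture.Cruxes.HLiu418.K2LiuArchSWDataInduction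

variable (L : Type) [Field L] [NumberField L] [IsCMField L] {n : ℕ} (e : Fin 2 × Fin 1 ≃ Fin n)
  (dV : Fin 2 → L) (hdV : ∀ i, IsCMField.complexConj L (dV i) = dV i) (hdV0 : ∀ i, dV i ≠ 0)
  (dW : Fin 1 → L) (hdW : ∀ i, IsCMField.complexConj L (dW i) = dW i) (hdW0 : ∀ i, dW i ≠ 0)
  {M' n' : ℕ} (eW : Fin 1 × Fin 3 ≃ Fin M') (e' : Fin 2 × Fin M' ≃ Fin n')
  (dV' : Fin 3 → L) (hdV' : ∀ k, IsCMField.complexConj L (dV' k) = dV' k) (hdV'0 : ∀ k, dV' k ≠ 0)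
  (χb : HeckeCharacter L) (hχbu : χb.IsUnitary) (hχbs : Literature.RepresentationTheory.HarrisKudlaSweet1996.IsSplittingChar L 1 χb)
  (α : UnitaryGroup.adelicOne (Fp L) L (IsCMField.complexConj L) →* ℂˣ) (𝒦 : IwasawaDatum L e dV hdV dW hdW)
  (R S : {v : InfinitePlace (Fp L) // v.IsReal} → Type) [∀ σ, Fintype (R σ)] [∀ σ, DecidableEq (R σ)] [∀ σ, Fintype (S σ)] [∀ σ, DecidableEq (S σ)]
  (eP : ∀ σ : {v : InfinitePlace (Fp L) // v.IsReal}, PosIdx (signVec (cmPlaceOver L) (fun k => Sum.elim (cmGramEntry L e' dV hdV (tensorFrame L dW eW dV') (tensorFrame_real L dW hdW eW dV' hdV')) (-cmGramEntry L e' dV hdV (tensorFrame L dW eW dV') (tensorFrame_real L dW hdW eW dV' hdV')) ((LocalSplitting.e₂ n').symm k)) (imagUnit L) σ) ≃ (Fin 2 × R σ) ⊕ (Fin 2 × S σ))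
  (eQ : ∀ σ : {v : InfinitePlace (Fp L) // v.IsReal}, NegIdx (signVec (cmPlaceOver L) (fun k => Sum.elim (cmGramEntry L e' dV hdV (tensorFrame L dW eW dV') (tensorFrame_real L dW hdW eW dV' hdV')) (-cmGramEntry L e' dV hdV (tensorFrame L dW eW dV') (tensorFrame_real L dW hdW eW dV' hdV')) ((LocalSplitting.e₂ n').symm k)) (imagUnit L) σ) ≃ (Fin 2 × S σ) ⊕ (Fin 2 × R σ))
  (ev : {v : InfinitePlace (Fp L) // v.IsReal} → VacExponents)

/-! ## §1 Linearity of the generator family; the (vac) letter from (base) -/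

set_option maxHeartbeats 4000000 in -- the doubled-carrier telescope of socket #42F′ (as ★ `K2LiuFaceGLetterDefs`)
/-- **`g_{Φ+Ψ} = g_Φ + g_Ψ`** (★ `swSectionTensor_add`; ★ 0c `twistedGen_add` in `genFamily` spelling). [cite: KudlaRallis1994, §1 Thm. 1.1]
[cite: HarrisKudlaSweet1996, §1 (1.15)–(1.17)] -/
theorem genFamily_add (Φ Ψ : piSchwartzBruhat (Fp L) (Fin (n' + n'))) :
    genFamily L e dV hdV hdV0 dW hdW hdW0 eW e' dV' hdV' hdV'0 χb hχbu hχbs α 𝒦 (Φ + Ψ) =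
      genFamily L e dV hdV hdV0 dW hdW hdW0 eW e' dV' hdV' hdV'0 χb hχbu hχbs α 𝒦 Φ + genFamily L e dV hdV hdV0 dW hdW hdW0 eW e' dV' hdV' hdV'0 χb hχbu hχbs α 𝒦 Ψ := by
  funext z h
  simp only [K2LiuFaceGLetterDefs.genFamily, Pi.add_apply, stdExtension]
  rw [swSectionTensor_add]
  ring

set_option maxHeartbeats 4000000 in
/-- **`g_{c•Φ} = c • g_Φ`** (★ `swSectionTensor_smul`). [cite: KudlaRallis1994, §1 Thm. 1.1] [cite: HarrisKudlaSweet1996, §1 (1.15)–(1.17)] -/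
theorem genFamily_smul (c : ℂ) (Φ : piSchwartzBruhat (Fp L) (Fin (n' + n'))) :
    genFamily L e dV hdV hdV0 dW hdW hdW0 eW e' dV' hdV' hdV'0 χb hχbu hχbs α 𝒦 (c • Φ) = c • genFamily L e dV hdV hdV0 dW hdW hdW0 eW e' dV' hdV' hdV'0 χb hχbu hχbs α 𝒦 Φ := by
  funext z h
  simp only [K2LiuFaceGLetterDefs.genFamily, Pi.smul_apply, smul_eq_mul, stdExtension]
  rw [swSectionTensor_smul]
  ring

omit [∀ σ, Fintype (R σ)] [∀ σ, DecidableEq (R σ)] [∀ σ, Fintype (S σ)] [∀ σ, DecidableEq (S σ)] in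
set_option maxHeartbeats 4000000 in
/-- **THE (vac) LETTER FROM (base)**: if `Good` holds on every admissible hol-cut domain ((base) of ★ `hGgen`, the hol-cut predicate read as a property `HL₀` of
subspaces) and SOME admissible hol-cut domain contains the all-vacuum tuple vector `tupleVec 1` (= ★ `archGaussianOfRecord`, the scaled Gaussian of the doubled
frame), then by (congr) `Good` holds at `E(tupleVec 1 ⊗ f)` in EVERY admissible domain containing it. [cite: KudlaRallis1994, §3] [cite: Folland1989, Prop. (4.39)] -/
theorem vac_good_of_base
    (Good : (V : Submodule ℂ 𝓢(((Fin (n' + n')) → mixedSpace (Fp L)), ℂ)) → ↥(Submodule.span ℂ {x : piSchwartzBruhat (Fp L) (Fin (n' + n')) |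
          ∃ a ∈ V, ∃ f : FinSB (Fp L) (Fin (n' + n')), x = piSchwartzBruhatEquiv (Fp L) (Fin (n' + n')) (a ⊗ₜ[ℂ] f)}) → Prop)
    (HL₀ : Submodule ℂ 𝓢(((Fin (n' + n')) → mixedSpace (Fp L)), ℂ) → Prop)
    (hbase : ∀ (V₀ : Submodule ℂ 𝓢(((Fin (n' + n')) → mixedSpace (Fp L)), ℂ)), FiniteDimensional ℂ V₀ → IsArchStable L e dV hdV hdV0 dW hdW hdW0 eW e' dV' hdV' hdV'0 χb hχbu hχbs 𝒦 V₀ →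
      HL₀ V₀ → ∀ x₀ : ↥(Submodule.span ℂ {x : piSchwartzBruhat (Fp L) (Fin (n' + n')) |
          ∃ a ∈ V₀, ∃ f : FinSB (Fp L) (Fin (n' + n')), x = piSchwartzBruhatEquiv (Fp L) (Fin (n' + n')) (a ⊗ₜ[ℂ] f)}), Good V₀ x₀)
    (hcongr : ∀ (V V' : Submodule ℂ 𝓢(((Fin (n' + n')) → mixedSpace (Fp L)), ℂ)) (x : ↥(Submodule.span ℂ {x : piSchwartzBruhat (Fp L) (Fin (n' + n')) |
          ∃ a ∈ V, ∃ f : FinSB (Fp L) (Fin (n' + n')), x = piSchwartzBruhatEquiv (Fp L) (Fin (n' + n')) (a ⊗ₜ[ℂ] f)})) (x' : ↥(Submodule.span ℂ {x : piSchwartzBruhat (Fp L) (Fin (n' + n')) |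
          ∃ a ∈ V', ∃ f : FinSB (Fp L) (Fin (n' + n')), x = piSchwartzBruhatEquiv (Fp L) (Fin (n' + n')) (a ⊗ₜ[ℂ] f)})),
      genFamily L e dV hdV hdV0 dW hdW hdW0 eW e' dV' hdV' hdV'0 χb hχbu hχbs α 𝒦 (x : piSchwartzBruhat (Fp L) (Fin (n' + n'))) =
        genFamily L e dV hdV hdV0 dW hdW hdW0 eW e' dV' hdV' hdV'0 χb hχbu hχbs α 𝒦 (x' : piSchwartzBruhat (Fp L) (Fin (n' + n'))) → Good V x → Good V' x')
    (hHL : ∃ V₀ : Submodule ℂ 𝓢(((Fin (n' + n')) → mixedSpace (Fp L)), ℂ), FiniteDimensional ℂ V₀ ∧ IsArchStable L e dV hdV hdV0 dW hdW hdW0 eW e' dV' hdV' hdV'0 χb hχbu hχbs 𝒦 V₀ ∧ HL₀ V₀ ∧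
      tupleVec L dV hdV hdV0 dW hdW hdW0 eW e' dV' hdV' hdV'0 R S eP eQ (fun _ => 1) ∈ V₀) :
    ∀ f : FinSB (Fp L) (Fin (n' + n')), (∀ V' : Submodule ℂ 𝓢(((Fin (n' + n')) → mixedSpace (Fp L)), ℂ), FiniteDimensional ℂ V' →
      IsArchStable L e dV hdV hdV0 dW hdW hdW0 eW e' dV' hdV' hdV'0 χb hχbu hχbs 𝒦 V' →
      ∀ hx : piSchwartzBruhatEquiv (Fp L) (Fin (n' + n')) (tupleVec L dV hdV hdV0 dW hdW hdW0 eW e' dV' hdV' hdV'0 R S eP eQ (fun _ => 1) ⊗ₜ[ℂ] f) ∈ Submodule.span ℂ {x : piSchwartzBruhat (Fp L) (Fin (n' + n')) |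
          ∃ a ∈ V', ∃ f : FinSB (Fp L) (Fin (n' + n')), x = piSchwartzBruhatEquiv (Fp L) (Fin (n' + n')) (a ⊗ₜ[ℂ] f)},
        Good V' ⟨piSchwartzBruhatEquiv (Fp L) (Fin (n' + n')) (tupleVec L dV hdV hdV0 dW hdW hdW0 eW e' dV' hdV' hdV'0 R S eP eQ (fun _ => 1) ⊗ₜ[ℂ] f), hx⟩) := by
  intro f V' _hfd _hst hx
  obtain ⟨V₀, h0fd, h0st, hHL0, hmem⟩ := hHL
  have hx₀ : piSchwartzBruhatEquiv (Fp L) (Fin (n' + n')) (tupleVec L dV hdV hdV0 dW hdW hdW0 eW e' dV' hdV' hdV'0 R S eP eQ (fun _ => 1) ⊗ₜ[ℂ] f) ∈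
      Submodule.span ℂ {x : piSchwartzBruhat (Fp L) (Fin (n' + n')) |
          ∃ a ∈ V₀, ∃ f : FinSB (Fp L) (Fin (n' + n')), x = piSchwartzBruhatEquiv (Fp L) (Fin (n' + n')) (a ⊗ₜ[ℂ] f)} :=
    Submodule.subset_span ⟨_, hmem, f, rfl⟩
  exact hcongr V₀ V' ⟨_, hx₀⟩ ⟨_, hx⟩ rfl (hbase V₀ h0fd h0st hHL0 ⟨_, hx₀⟩)

/-! ## §2 The place-tuple induction for an abstract family of one-place frames -/

set_option maxHeartbeats 4000000 in
/-- **B3-b — `Good` AT EVERY TUPLE VECTOR, for an abstract family of one-place frames `J σ`** reading every tuple vector as «(`σ`-slot) ⊠ (rest)»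
(`hJ`, = ★ FILE 1 `frame_tupleVec_eq_tensorPi` for `J := 𝒥`).  Hypotheses: `hGgen`'s closure letters (congr)(zero)(add)(smul)(deriv) verbatim; (dom) (★ FILE 3 bytes
at `t := tupleVec`); per real place `σ`: the see-saw pivot (piv) in `ha`-form, the block first fundamental theorems `hR hS` (★ B3-a ED. 3 bytes), the derivative
letters (DX⁺)(DX⁻) (`Good`-free, tuple level); and (vac).  Conclusion: ★ FILE 3's letter (gen) at `t := tupleVec` — `Good V′ ⟨E(tupleVec a ⊗ f), hx⟩` for every tuple
`a`, every `f` and every finite-dimensional arch-stable `V′` whose domain contains it.  Proof: ★ FILE 2a `goodAt_tuple_of_placeLetters` at `SW σ rest :=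
v ↦ g (E (J σ)⁻¹((e_* v) ⊠ B⁻¹(tupleRest σ rest)) f)` (linear by ★ `tensorPi_add_left ∕ _smul_left` and §1). [cite: Howe1989, §3] [cite: KudlaRallis1994, §3]
[cite: Folland1989, §1.7 (1.81), Prop. (4.39)] [cite: Weil1964, Chap. I n° 12 p. 160] -/
theorem good_tupleVec_of_frame
    (Good : (V : Submodule ℂ 𝓢(((Fin (n' + n')) → mixedSpace (Fp L)), ℂ)) → ↥(Submodule.span ℂ {x : piSchwartzBruhat (Fp L) (Fin (n' + n')) |
          ∃ a ∈ V, ∃ f : FinSB (Fp L) (Fin (n' + n')), x = piSchwartzBruhatEquiv (Fp L) (Fin (n' + n')) (a ⊗ₜ[ℂ] f)}) → Prop)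
    -- (congr) (zero) (add) (smul) (deriv): ★ `hGgen` bytes verbatim
    (hcongr : ∀ (V V' : Submodule ℂ 𝓢(((Fin (n' + n')) → mixedSpace (Fp L)), ℂ)) (x : ↥(Submodule.span ℂ {x : piSchwartzBruhat (Fp L) (Fin (n' + n')) |
          ∃ a ∈ V, ∃ f : FinSB (Fp L) (Fin (n' + n')), x = piSchwartzBruhatEquiv (Fp L) (Fin (n' + n')) (a ⊗ₜ[ℂ] f)})) (x' : ↥(Submodule.span ℂ {x : piSchwartzBruhat (Fp L) (Fin (n' + n')) |
          ∃ a ∈ V', ∃ f : FinSB (Fp L) (Fin (n' + n')), x = piSchwartzBruhatEquiv (Fp L) (Fin (n' + n')) (a ⊗ₜ[ℂ] f)})),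
      genFamily L e dV hdV hdV0 dW hdW hdW0 eW e' dV' hdV' hdV'0 χb hχbu hχbs α 𝒦 (x : piSchwartzBruhat (Fp L) (Fin (n' + n'))) =
        genFamily L e dV hdV hdV0 dW hdW hdW0 eW e' dV' hdV' hdV'0 χb hχbu hχbs α 𝒦 (x' : piSchwartzBruhat (Fp L) (Fin (n' + n'))) → Good V x → Good V' x')
    (hzero : ∀ (V : Submodule ℂ 𝓢(((Fin (n' + n')) → mixedSpace (Fp L)), ℂ)), FiniteDimensional ℂ V → IsArchStable L e dV hdV hdV0 dW hdW hdW0 eW e' dV' hdV' hdV'0 χb hχbu hχbs 𝒦 V → Good V 0)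
    (hadd : ∀ (V : Submodule ℂ 𝓢(((Fin (n' + n')) → mixedSpace (Fp L)), ℂ)), FiniteDimensional ℂ V → IsArchStable L e dV hdV hdV0 dW hdW hdW0 eW e' dV' hdV' hdV'0 χb hχbu hχbs 𝒦 V →
      ∀ x y : ↥(Submodule.span ℂ {x : piSchwartzBruhat (Fp L) (Fin (n' + n')) |
          ∃ a ∈ V, ∃ f : FinSB (Fp L) (Fin (n' + n')), x = piSchwartzBruhatEquiv (Fp L) (Fin (n' + n')) (a ⊗ₜ[ℂ] f)}), Good V x → Good V y → Good V (x + y))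
    (hsmul : ∀ (V : Submodule ℂ 𝓢(((Fin (n' + n')) → mixedSpace (Fp L)), ℂ)), FiniteDimensional ℂ V → IsArchStable L e dV hdV hdV0 dW hdW hdW0 eW e' dV' hdV' hdV'0 χb hχbu hχbs 𝒦 V →
      ∀ (c : ℂ) (x : ↥(Submodule.span ℂ {x : piSchwartzBruhat (Fp L) (Fin (n' + n')) |
          ∃ a ∈ V, ∃ f : FinSB (Fp L) (Fin (n' + n')), x = piSchwartzBruhatEquiv (Fp L) (Fin (n' + n')) (a ⊗ₜ[ℂ] f)})), Good V x → Good V (c • x))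
    (hderiv : ∀ (V : Submodule ℂ 𝓢(((Fin (n' + n')) → mixedSpace (Fp L)), ℂ)), FiniteDimensional ℂ V → IsArchStable L e dV hdV hdV0 dW hdW hdW0 eW e' dV' hdV' hdV'0 χb hχbu hχbs 𝒦 V →
          ∀ x : ↥(Submodule.span ℂ {x : piSchwartzBruhat (Fp L) (Fin (n' + n')) |
          ∃ a ∈ V, ∃ f : FinSB (Fp L) (Fin (n' + n')), x = piSchwartzBruhatEquiv (Fp L) (Fin (n' + n')) (a ⊗ₜ[ℂ] f)}), Good V x →
          ∀ (X : Matrix (Fin (n + n)) (Fin (n + n)) (mixedSpace L)) (hX : X ∈ archSkew (Fp L) L (IsCMField.complexConj L) (n + n) (hermD L e dV hdV dW hdW))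
            (V' : Submodule ℂ 𝓢(((Fin (n' + n')) → mixedSpace (Fp L)), ℂ)), FiniteDimensional ℂ V' → IsArchStable L e dV hdV hdV0 dW hdW hdW0 eW e' dV' hdV' hdV'0 χb hχbu hχbs 𝒦 V' →
          ∀ x' : ↥(Submodule.span ℂ {x : piSchwartzBruhat (Fp L) (Fin (n' + n')) |
          ∃ a ∈ V', ∃ f : FinSB (Fp L) (Fin (n' + n')), x = piSchwartzBruhatEquiv (Fp L) (Fin (n' + n')) (a ⊗ₜ[ℂ] f)}),
          HasArchDeriv L e dV hdV dW hdW hX (fun h => genFamily L e dV hdV hdV0 dW hdW hdW0 eW e' dV' hdV' hdV'0 χb hχbu hχbs α 𝒦 (x : piSchwartzBruhat (Fp L) (Fin (n' + n'))) ((((3 : ℕ) : ℂ) - (n : ℂ)) / 2) h)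
            (fun h => genFamily L e dV hdV hdV0 dW hdW hdW0 eW e' dV' hdV' hdV'0 χb hχbu hχbs α 𝒦 (x' : piSchwartzBruhat (Fp L) (Fin (n' + n'))) ((((3 : ℕ) : ℂ) - (n : ℂ)) / 2) h) → Good V' x')
    -- (dom) the degree ledger BY VALUE: every finite set of tuple vectors lies in some finite-dimensional arch-stable space (★ FILE 3's letter bytes at `t := tupleVec`)
    (hdom : ∀ s : Finset ((σ : {v : InfinitePlace (Fp L) // v.IsReal}) → MvPolynomial (DPIdx (Fin 2) (Fin 2) (R σ) (S σ)) ℂ), ∃ V' : Submodule ℂ 𝓢(((Fin (n' + n')) → mixedSpace (Fp L)), ℂ),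
      FiniteDimensional ℂ V' ∧ IsArchStable L e dV hdV hdV0 dW hdW hdW0 eW e' dV' hdV' hdV'0 χb hχbu hχbs 𝒦 V' ∧ ∀ β ∈ s, tupleVec L dV hdV hdV0 dW hdW hdW0 eW e' dV' hdV' hdV'0 R S eP eQ β ∈ V')
    -- the one-place frames and their reading of tuple vectors
    (J : ∀ σ : {v : InfinitePlace (Fp L) // v.IsReal}, (𝓢(((Fin (n' + n')) → mixedSpace (Fp L)), ℂ) ≃L[ℂ]
      𝓢(((DPIdx ((Fin 2 × R σ) ⊕ (Fin 2 × S σ)) ((Fin 2 × S σ) ⊕ (Fin 2 × R σ)) Unit Empty ⊕ (Fin (n' + n') × {v : {v : InfinitePlace (Fp L) // v.IsReal} // v ≠ σ})) → ℝ), ℂ)))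
    (hJ : ∀ (σ : {v : InfinitePlace (Fp L) // v.IsReal}) (a : ((σ : {v : InfinitePlace (Fp L) // v.IsReal}) → MvPolynomial (DPIdx (Fin 2) (Fin 2) (R σ) (S σ)) ℂ)), J σ (tupleVec L dV hdV hdV0 dW hdW hdW0 eW e' dV' hdV' hdV'0 R S eP eQ a) =
      tensorPi (schwartzTransport (reindexCLE (unitJunctionIdx ((Fin 2 × R σ) ⊕ (Fin 2 × S σ)) ((Fin 2 × S σ) ⊕ (Fin 2 × R σ))).symm) (binvPi (a σ)))
        (binvPi (tupleRest (fun τ : {v : InfinitePlace (Fp L) // v.IsReal} => unitJunctionIdx ((Fin 2 × R τ) ⊕ (Fin 2 × S τ)) ((Fin 2 × S τ) ⊕ (Fin 2 × R τ)))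
          (frameSlotEquiv L dV hdV dW hdW eW e' dV' hdV' R S eP eQ) σ a)))
    -- (piv) THE SEE-SAW PIVOT BY VALUE, in ★ J2c's `ha`-form: moving the `σ`-slot by `κOp (1,k)`, `k ∈ K_H = U(R_σ) × U(S_σ)`, multiplies the twisted generator
    -- family by the vacuum scalar (★ (P-arch) p863113 + (R-grp) K2E3-p31 + ★ `swSection_mul_right` + ★ SW-law + ★ (R-scal) p863266; composed by the pivot file)
    (hpiv : ∀ (σ : {v : InfinitePlace (Fp L) // v.IsReal}) (k : Matrix.unitaryGroup (R σ) ℂ × Matrix.unitaryGroup (S σ) ℂ) (v : SchwartzMap (DPIdx (Fin 2) (Fin 2) (R σ) (S σ) → ℝ) ℂ)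
      (w : 𝓢(((Fin (n' + n') × {v : {v : InfinitePlace (Fp L) // v.IsReal} // v ≠ σ}) → ℝ), ℂ)) (f : FinSB (Fp L) (Fin (n' + n'))) (a a' : 𝓢(((Fin (n' + n')) → mixedSpace (Fp L)), ℂ)),
      J σ a = tensorPi (schwartzTransport (reindexCLE (unitJunctionIdx ((Fin 2 × R σ) ⊕ (Fin 2 × S σ)) ((Fin 2 × S σ) ⊕ (Fin 2 × R σ))).symm) v) w →
      J σ a' =
        tensorPi (schwartzTransport (reindexCLE (unitJunctionIdx ((Fin 2 × R σ) ⊕ (Fin 2 × S σ)) ((Fin 2 × S σ) ⊕ (Fin 2 × R σ))).symm) (κOp (R σ) (S σ) (ev σ) ((1, k) : DPK (Fin 2) (Fin 2) (R σ) (S σ)) v)) w →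
      genFamily L e dV hdV hdV0 dW hdW hdW0 eW e' dV' hdV' hdV'0 χb hχbu hχbs α 𝒦 (piSchwartzBruhatEquiv (Fp L) (Fin (n' + n')) (a' ⊗ₜ[ℂ] f)) =
        vacScalar (ev σ) ((1, k) : DPK (Fin 2) (Fin 2) (R σ) (S σ)) • genFamily L e dV hdV hdV0 dW hdW hdW0 eW e' dV' hdV' hdV'0 χb hχbu hχbs α 𝒦 (piSchwartzBruhatEquiv (Fp L) (Fin (n' + n')) (a ⊗ₜ[ℂ] f)))
    (hR : ∀ (σ : {v : InfinitePlace (Fp L) // v.IsReal}) (PR : MvPolynomial ((Fin 2 × R σ) ⊕ (Fin 2 × R σ)) ℂ),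
      (∀ c : Matrix.unitaryGroup (R σ) ℂ, aeval (Sum.elim (fun pr : Fin 2 × R σ => ∑ b : R σ, X (Sum.inl (pr.1, b)) * C ((c : Matrix (R σ) (R σ) ℂ) b pr.2))
          (fun qr : Fin 2 × R σ => ∑ b : R σ, X (Sum.inr (qr.1, b)) * C ((star (c : Matrix (R σ) (R σ) ℂ)) qr.2 b)) :
            (Fin 2 × R σ) ⊕ (Fin 2 × R σ) → MvPolynomial ((Fin 2 × R σ) ⊕ (Fin 2 × R σ)) ℂ) PR = PR) →
        PR ∈ Algebra.adjoin ℂ (Set.range fun ij : Fin 2 × Fin 2 =>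
          (∑ r : R σ, X (Sum.inl (ij.1, r)) * X (Sum.inr (ij.2, r)) : MvPolynomial ((Fin 2 × R σ) ⊕ (Fin 2 × R σ)) ℂ)))
    (hS : ∀ (σ : {v : InfinitePlace (Fp L) // v.IsReal}) (PS : MvPolynomial ((Fin 2 × S σ) ⊕ (Fin 2 × S σ)) ℂ),
      (∀ d : Matrix.unitaryGroup (S σ) ℂ, aeval (Sum.elim (fun pr : Fin 2 × S σ => ∑ b : S σ, X (Sum.inl (pr.1, b)) * C ((d : Matrix (S σ) (S σ) ℂ) b pr.2))
          (fun qr : Fin 2 × S σ => ∑ b : S σ, X (Sum.inr (qr.1, b)) * C ((star (d : Matrix (S σ) (S σ) ℂ)) qr.2 b)) :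
            (Fin 2 × S σ) ⊕ (Fin 2 × S σ) → MvPolynomial ((Fin 2 × S σ) ⊕ (Fin 2 × S σ)) ℂ) PS = PS) →
        PS ∈ Algebra.adjoin ℂ (Set.range fun ij : Fin 2 × Fin 2 =>
          (∑ s : S σ, X (Sum.inl (ij.2, s)) * X (Sum.inr (ij.1, s)) : MvPolynomial ((Fin 2 × S σ) ⊕ (Fin 2 × S σ)) ℂ)))
    -- (DX⁺) (DX⁻) the two derivative letters per place BY VALUE (`Good`-free): the boost `hypOpGen_{pq}` (resp. its `μ₀(D_{π∕2})`-conjugate) of the `σ`-slot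
    -- is the arch Lie derivative of the twisted generator family along some `X ∈ 𝔲` (★ W4 + ★ F2 + ★ (T2-an) + ★ FILE 1; payer named by LEAD)
    (hDXp : ∀ (σ : {v : InfinitePlace (Fp L) // v.IsReal}) (rest : ((τ : {v : InfinitePlace (Fp L) // v.IsReal}) → MvPolynomial (DPIdx (Fin 2) (Fin 2) (R τ) (S τ)) ℂ)) (i : Fin 2 × Fin 2) (F : MvPolynomial (DPIdx (Fin 2) (Fin 2) (R σ) (S σ)) ℂ) (f : FinSB (Fp L) (Fin (n' + n'))),
      ∃ (X : Matrix (Fin (n + n)) (Fin (n + n)) (mixedSpace L)) (hX : X ∈ archSkew (Fp L) L (IsCMField.complexConj L) (n + n) (hermD L e dV hdV dW hdW))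
        (c : ℂ) (G : MvPolynomial (DPIdx (Fin 2) (Fin 2) (R σ) (S σ)) ℂ), binvPi G = hypOpGenC (R σ) (S σ) i.1 i.2 (binvPi F) ∧
        HasArchDeriv L e dV hdV dW hdW hX (fun h => genFamily L e dV hdV hdV0 dW hdW hdW0 eW e' dV' hdV' hdV'0 χb hχbu hχbs α 𝒦 (piSchwartzBruhatEquiv (Fp L) (Fin (n' + n')) (tupleVec L dV hdV hdV0 dW hdW hdW0 eW e' dV' hdV' hdV'0 R S eP eQ (Function.update rest σ F) ⊗ₜ[ℂ] f)) ((((3 : ℕ) : ℂ) - (n : ℂ)) / 2) h)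
          (fun h => genFamily L e dV hdV hdV0 dW hdW hdW0 eW e' dV' hdV' hdV'0 χb hχbu hχbs α 𝒦 (piSchwartzBruhatEquiv (Fp L) (Fin (n' + n')) (tupleVec L dV hdV hdV0 dW hdW hdW0 eW e' dV' hdV' hdV'0 R S eP eQ (Function.update rest σ (c • F + G)) ⊗ₜ[ℂ] f)) ((((3 : ℕ) : ℂ) - (n : ℂ)) / 2) h))
    (hDXm : ∀ (σ : {v : InfinitePlace (Fp L) // v.IsReal}) (rest : ((τ : {v : InfinitePlace (Fp L) // v.IsReal}) → MvPolynomial (DPIdx (Fin 2) (Fin 2) (R τ) (S τ)) ℂ)) (i : Fin 2 × Fin 2) (F : MvPolynomial (DPIdx (Fin 2) (Fin 2) (R σ) (S σ)) ℂ) (f : FinSB (Fp L) (Fin (n' + n'))),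
      ∃ (X : Matrix (Fin (n + n)) (Fin (n + n)) (mixedSpace L)) (hX : X ∈ archSkew (Fp L) L (IsCMField.complexConj L) (n + n) (hermD L e dV hdV dW hdW))
        (c : ℂ) (G : MvPolynomial (DPIdx (Fin 2) (Fin 2) (R σ) (S σ)) ℂ),
        binvPi G = unitaryOpPi (phaseU (R σ) (S σ) i.1 (π / 2)) (hypOpGenC (R σ) (S σ) i.1 i.2 (unitaryOpPi (phaseU (R σ) (S σ) i.1 (π / 2))⁻¹ (binvPi F))) ∧
        HasArchDeriv L e dV hdV dW hdW hX (fun h => genFamily L e dV hdV hdV0 dW hdW hdW0 eW e' dV' hdV' hdV'0 χb hχbu hχbs α 𝒦 (piSchwartzBruhatEquiv (Fp L) (Fin (n' + n')) (tupleVec L dV hdV hdV0 dW hdW hdW0 eW e' dV' hdV' hdV'0 R S eP eQ (Function.update rest σ F) ⊗ₜ[ℂ] f)) ((((3 : ℕ) : ℂ) - (n : ℂ)) / 2) h)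
          (fun h => genFamily L e dV hdV hdV0 dW hdW hdW0 eW e' dV' hdV' hdV'0 χb hχbu hχbs α 𝒦 (piSchwartzBruhatEquiv (Fp L) (Fin (n' + n')) (tupleVec L dV hdV hdV0 dW hdW hdW0 eW e' dV' hdV' hdV'0 R S eP eQ (Function.update rest σ (c • F + G)) ⊗ₜ[ℂ] f)) ((((3 : ℕ) : ℂ) - (n : ℂ)) / 2) h))
    -- (vac) `Good` at the all-vacuum tuple (`tupleVec 1` = ★ `archGaussianOfRecord`) in every admissible domain containing it — (base) + (congr), cf. `vac_good_of_base`
    (hvac : ∀ f : FinSB (Fp L) (Fin (n' + n')), (∀ V' : Submodule ℂ 𝓢(((Fin (n' + n')) → mixedSpace (Fp L)), ℂ), FiniteDimensional ℂ V' →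
      IsArchStable L e dV hdV hdV0 dW hdW hdW0 eW e' dV' hdV' hdV'0 χb hχbu hχbs 𝒦 V' →
      ∀ hx : piSchwartzBruhatEquiv (Fp L) (Fin (n' + n')) (tupleVec L dV hdV hdV0 dW hdW hdW0 eW e' dV' hdV' hdV'0 R S eP eQ (fun _ => 1) ⊗ₜ[ℂ] f) ∈ Submodule.span ℂ {x : piSchwartzBruhat (Fp L) (Fin (n' + n')) |
          ∃ a ∈ V', ∃ f : FinSB (Fp L) (Fin (n' + n')), x = piSchwartzBruhatEquiv (Fp L) (Fin (n' + n')) (a ⊗ₜ[ℂ] f)},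
        Good V' ⟨piSchwartzBruhatEquiv (Fp L) (Fin (n' + n')) (tupleVec L dV hdV hdV0 dW hdW hdW0 eW e' dV' hdV' hdV'0 R S eP eQ (fun _ => 1) ⊗ₜ[ℂ] f), hx⟩)) :
    ∀ (a : ((σ : {v : InfinitePlace (Fp L) // v.IsReal}) → MvPolynomial (DPIdx (Fin 2) (Fin 2) (R σ) (S σ)) ℂ)) (f : FinSB (Fp L) (Fin (n' + n'))) (V' : Submodule ℂ 𝓢(((Fin (n' + n')) → mixedSpace (Fp L)), ℂ)), FiniteDimensional ℂ V' →
      IsArchStable L e dV hdV hdV0 dW hdW hdW0 eW e' dV' hdV' hdV'0 χb hχbu hχbs 𝒦 V' →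
      ∀ hx : piSchwartzBruhatEquiv (Fp L) (Fin (n' + n')) (tupleVec L dV hdV hdV0 dW hdW hdW0 eW e' dV' hdV' hdV'0 R S eP eQ a ⊗ₜ[ℂ] f) ∈ Submodule.span ℂ {x : piSchwartzBruhat (Fp L) (Fin (n' + n')) |
          ∃ a ∈ V', ∃ f : FinSB (Fp L) (Fin (n' + n')), x = piSchwartzBruhatEquiv (Fp L) (Fin (n' + n')) (a ⊗ₜ[ℂ] f)},
        Good V' ⟨piSchwartzBruhatEquiv (Fp L) (Fin (n' + n')) (tupleVec L dV hdV hdV0 dW hdW hdW0 eW e' dV' hdV' hdV'0 R S eP eQ a ⊗ₜ[ℂ] f), hx⟩ := by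
  intro a f V' hfd hst hx
  have hGadd := genFamily_add L e dV hdV hdV0 dW hdW hdW0 eW e' dV' hdV' hdV'0 χb hχbu hχbs α 𝒦
  have hGsmul := genFamily_smul L e dV hdV hdV0 dW hdW hdW0 eW e' dV' hdV' hdV'0 χb hχbu hχbs α 𝒦
  have key := goodAt_tuple_of_placeLetters (M := 𝓢(((Fin (n' + n')) → mixedSpace (Fp L)), ℂ)) (T := FinSB (Fp L) (Fin (n' + n'))) (N := piSchwartzBruhat (Fp L) (Fin (n' + n')))
    (Y := ℂ → HA L e dV hdV dW hdW → ℂ)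
    (fun (a : 𝓢(((Fin (n' + n')) → mixedSpace (Fp L)), ℂ)) (f : FinSB (Fp L) (Fin (n' + n'))) => piSchwartzBruhatEquiv (Fp L) (Fin (n' + n')) (a ⊗ₜ[ℂ] f))
    (fun V => FiniteDimensional ℂ V ∧ IsArchStable L e dV hdV hdV0 dW hdW hdW0 eW e' dV' hdV' hdV'0 χb hχbu hχbs 𝒦 V)
    (fun x => genFamily L e dV hdV hdV0 dW hdW hdW0 eW e' dV' hdV' hdV'0 χb hχbu hχbs α 𝒦 x) Good
    (Ξ := {X : Matrix (Fin (n + n)) (Fin (n + n)) (mixedSpace L) // X ∈ archSkew (Fp L) L (IsCMField.complexConj L) (n + n) (hermD L e dV hdV dW hdW)})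
    (fun ξ y y' => HasArchDeriv L e dV hdV dW hdW ξ.2 (fun h => y ((((3 : ℕ) : ℂ) - (n : ℂ)) / 2) h) (fun h => y' ((((3 : ℕ) : ℂ) - (n : ℂ)) / 2) h))
    R S ev (tupleVec L dV hdV hdV0 dW hdW hdW0 eW e' dV' hdV' hdV'0 R S eP eQ)
    (fun σ rest F G => tupleVecOf_update_add (fun τ : {v : InfinitePlace (Fp L) // v.IsReal} => unitJunctionIdx ((Fin 2 × R τ) ⊕ (Fin 2 × S τ)) ((Fin 2 × S τ) ⊕ (Fin 2 × R τ)))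
      (frameSlotEquiv L dV hdV dW hdW eW e' dV' hdV' R S eP eQ) (frameD L e' dV hdV hdV0 (tensorFrame L dW eW dV') (tensorFrame_real L dW hdW eW dV' hdV') (tensorFrame_ne_zero L dW eW dV' hdW0 hdV'0)) σ rest F G)
    (fun σ rest c F => tupleVecOf_update_smul (fun τ : {v : InfinitePlace (Fp L) // v.IsReal} => unitJunctionIdx ((Fin 2 × R τ) ⊕ (Fin 2 × S τ)) ((Fin 2 × S τ) ⊕ (Fin 2 × R τ)))
      (frameSlotEquiv L dV hdV dW hdW eW e' dV' hdV' R S eP eQ) (frameD L e' dV hdV hdV0 (tensorFrame L dW eW dV') (tensorFrame_real L dW hdW eW dV' hdV') (tensorFrame_ne_zero L dW eW dV' hdW0 hdV'0)) σ rest c F)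
    -- `SW σ rest`: the twisted generator family of the datum whose `σ`-slot is `v` and whose other slots are `B⁻¹(tupleRest σ rest)`
    (fun σ rest =>
      { toFun := fun v => genFamily L e dV hdV hdV0 dW hdW hdW0 eW e' dV' hdV' hdV'0 χb hχbu hχbs α 𝒦 (piSchwartzBruhatEquiv (Fp L) (Fin (n' + n')) ((J σ).symm (tensorPi (schwartzTransport (reindexCLE (unitJunctionIdx ((Fin 2 × R σ) ⊕ (Fin 2 × S σ)) ((Fin 2 × S σ) ⊕ (Fin 2 × R σ))).symm) v) (binvPi (tupleRest (fun τ : {v : InfinitePlace (Fp L) // v.IsReal} => unitJunctionIdx ((Fin 2 × R τ) ⊕ (Fin 2 × S τ)) ((Fin 2 × S τ) ⊕ (Fin 2 × R τ)))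
          (frameSlotEquiv L dV hdV dW hdW eW e' dV' hdV' R S eP eQ) σ rest))) ⊗ₜ[ℂ] f))
        map_add' := fun v v' => by
          simp only [map_add, tensorPi_add_left, TensorProduct.add_tmul, hGadd]
        map_smul' := fun c v => by
          simp only [map_smul, tensorPi_smul_left]
          rw [← TensorProduct.smul_tmul', map_smul, hGsmul, RingHom.id_apply] })
    (fun σ rest k v => by
      simp only [LinearMap.coe_mk, AddHom.coe_mk]
      exact hpiv σ k v _ f _ _ (by rw [ContinuousLinearEquiv.apply_symm_apply]) (by rw [ContinuousLinearEquiv.apply_symm_apply]))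
    hR hS
    (fun a b f => by simp only [TensorProduct.add_tmul, map_add])
    (fun c a f => by simp only [← TensorProduct.smul_tmul', map_smul])
    hcongr (fun V h => hzero V h.1 h.2) (fun V h => hadd V h.1 h.2) (fun V h => hsmul V h.1 h.2)
    (fun V h x hx ξ V' h' x' hD => hderiv V h.1 h.2 x hx ξ.1 ξ.2 V' h'.1 h'.2 x' hD)
    (fun a b => by
      obtain ⟨V', h1, h2, h3⟩ := hdom {a, b}
      exact ⟨V', ⟨h1, h2⟩, h3 a (Finset.mem_insert_self a _), h3 b (Finset.mem_insert_of_mem (Finset.mem_singleton_self b))⟩)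
    f
    (fun σ rest F => by
      simp only [LinearMap.coe_mk, AddHom.coe_mk]
      have h := hJ σ (Function.update rest σ F)
      rw [Function.update_self, tupleRest_update] at h
      rw [← h, ContinuousLinearEquiv.symm_apply_apply])
    (fun σ rest i F => by
      obtain ⟨X, hX, c, G, hG, hD⟩ := hDXp σ rest i F f
      exact ⟨⟨X, hX⟩, c, G, hG, hD⟩)
    (fun σ rest i F => by
      obtain ⟨X, hX, c, G, hG, hD⟩ := hDXm σ rest i F f
      exact ⟨⟨X, hX⟩, c, G, hG, hD⟩)
    (fun V' h hx => hvac f V' h.1 h.2 hx) a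
  exact key V' ⟨hfd, hst⟩ hx

end Summit.HodgeConjecture.HodgeConjecture.Cruxes.HLiu418.K2LiuArchSWDataInduction

end
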